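import Summits.QuantumFields.YangMills.Theorems.UnitScaleTiltProp7DeltaPrimeL2Bound
import HarnessLib

/-!
# Route `UnitScaleTilt`, crux K1 «MinimiserStabilityRegPr» (stmt-QuantumFields-19200) — route-R E′ (A′), RULING g28-№13 ∕ ACK 91 (3) ∕ ★★OWNER 02:02Z YES, T2 part 2∕2:
# **ALMOST-POSITIVITY OF THE WILSON HESSIAN `Δ^η(U₀)` IN `L²` ON THE PRINTED-REGULAR CLASS** — `−1029·ε₀·‖y‖² ≤ re⟪y, Δ^η(U₀) y⟫` for EVERY `y` of the weighted `L²` space, on `RegPr F n K ε₀ U₀`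

Cell `ym3-torus`, width seat `ym-ust-19200-w4` (gen 8); ★p1 g17 WORD 13 («(COERC) ⟸ `norm_G₀` + almost-positivity of `Δ^η` ((3.10)) … by w4's T2»), WORD 14.  THEOREMS ONLY (0 `def`, 0 `sorry`);
`--supports stmt-QuantumFields-19200`, count-neutral.  YM₃ on T³ is a ladder rung (R3), not the Clay problem; nothing here claims [Balaban1985BackgroundPropagators] Thm 3.3∕3.11, HESS at
`IsCritR2`, `hcoW`, E′, EX, the crux, d = 4 or the mass gap.

WHY.  ✓`Prop7CoerciveOfInverseBound.coercive_laplaceA_of_almostPos_of_inverse_bound` turns {almost-positivity `re⟪y, Δx(U₀)y⟫ ≥ −θ‖y‖²`} + {an `L²` right-inverse bound `norm_G₀`} into the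
quantitative coercivity row of `Δ_a(U₀) = Δx + D R_S D* + Q_k†aQ_k` (RULING g28-№13 (2), refined ACK 91 (3)).  This file supplies the first input at the slot of record `Δx := DeltaEtaSlot`
(print's `Δ^η(U₀)`, ✓`Prop7SectET3WilsonHessian`): by (3.10) `Δ^η = η⁻²(D¹*D¹ + Δ′₁)` (✓`symm_DeltaEta_toL2_apply`); the `D¹*D¹` part is a SUM OF SQUARES on ALL complex one-forms ((3.9)
adjointness lit ✓`B9Eq39Adjoint.sum_posPlaq_curl_mul` read with `A := X†`, `(D¹X)† = D¹(X†)` at a unitary background lit ✓`B9Eq310Hermitian.star_curl`), and the `Δ′₁` part is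
`≤ 1029·ε₀η²` in `L²` (part 1∕2 ✓`Prop7DeltaPrimeL2Bound`); the `η⁻²` cancels the `η²`, `c₀` cancels in the quotient.

WHAT IS PROVED (ns `…Theorems.Prop7DeltaEtaAlmostPositive`): `sum_trace_conjTranspose_mul_covCodiffCurlT` (`Σ_b tr(X_b†(D¹*D¹X)_b) = Σ_p tr((D¹X)_p†(D¹X)_p)`), `…_eq_sum_sq`,
`re_sum_trace_conjTranspose_mul_covCodiffCurlT_nonneg`, `norm_toL2_sq` (`‖X̃‖² = c₀Σ_b‖X_b‖_F²`), ★★`re_inner_DeltaEta_toL2_eq` (the form of `Δ^η` = `c₀η⁻²·(D*D part + Δ′ part)`),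
★★★`re_inner_DeltaEta_toL2_ge` (`−1029ε₀‖X̃‖² ≤ re⟪X̃, Δ^ηX̃⟫`), ★★★`almostPos_DeltaEtaSlot_of_regPr` (the same for every `y`, at `DeltaEtaSlot`) — the `hθ` of
✓`coercive_laplaceA_of_almostPos_of_inverse_bound` with `θ := 1029·ε₀`; hence on `RegPr(α L)` the (A′) coercivity row follows from the `norm_G₀` row ALONE, `γ = 1∕B₀`, window `1029·α·B₀ < 1`.
HONEST SCOPE: linear algebra and lattice bookkeeping; `1029` is crude (`686√2`); nothing of Thm 3.3∕3.11 at curved `U₀` is claimed; rung R3, not Clay; YM gap NOT proved.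

References: T. Bałaban, CMP 99 (1985) 389–434 [Balaban1985BackgroundPropagators] ((3.9)–(3.12) p.392, (3.69) p.404, Thm 3.11 p.416); CMP 102 (1985) 277–309 [Balaban1985Variational]
((14) p.280, (141)–(142) p.299).
-/

set_option autoImplicit false

noncomputable section

open scoped Matrix.Norms.L2Operator BigOperators InnerProductSpace ComplexConjugate

namespace Summit.QuantumFields.YangMills.Theorems.Prop7DeltaEtaAlmostPositive

open Literature.MathematicalPhysics.QuantumFieldTheory.Balaban1983to89
open Literature.MathematicalPhysics.QuantumFieldTheory.Balaban1983to89.T3ContinuumYM3Torus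
open Literature.MathematicalPhysics.QuantumFieldTheory.Balaban1983to89.T3PrintedRegularMinimiser (RegPr)
open T3SectALandauChart (formComp bgUnits covCodiffCurlT eta eta_pos)
open B9TorusCalculus (torusT)
open B9Eq39Adjoint (curl divP posPlaq sum_posPlaq_curl_mul)
open B9Eq310Hermitian (deltaPrimeOp star_curl)
open B11Eq103H1Complex (BondL2K)
open Summit.QuantumFields.YangMills.Theorems.Prop7SectET3Transport (periodsT3)
open Summit.QuantumFields.YangMills.Theorems.Prop7SectET3HilbertLetters (W₂ frobEquiv toL2 inner_toL2 inner_frobEquiv_symm)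
open Summit.QuantumFields.YangMills.Theorems.Prop7SectET3WilsonHessian (DeltaEta DeltaEtaSlot DeltaEtaSlot_apply)
open Summit.QuantumFields.YangMills.Theorems.Prop7SecondOrderDict (covCodiffCurlT_one_eq)
open Summit.QuantumFields.YangMills.Theorems.Prop7SectET3DeltaEtaExplicit (symm_DeltaEta_toL2_apply val_inv_bgUnits_eq_star formComp_star sum_pbond_eq)
open Summit.QuantumFields.YangMills.Theorems.Prop7DeltaPrimeL2Bound (norm_sum_trace_conjTranspose_mul_deltaPrimeOp_le)

variable {F : T3Family} {n K : ℕ} {c₀ : ℝ}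

/-! ## §1 The `𝒟*𝒟` part of (3.10) is non-negative on COMPLEX one-forms -/

/-- **`Σ_b tr(X_b† (D¹*D¹_{U₀}X)_b) = Σ_{p} tr((D¹X)_p† (D¹X)_p)`** — (3.9) adjointness read with `A := X†` and `((D¹X)_p)† = (D¹X†)_p` at a unitary background.
[cite: Balaban1985BackgroundPropagators, (3.9)–(3.10) p.392] -/
theorem sum_trace_conjTranspose_mul_covCodiffCurlT (U₀ : GaugeField (F.P K) 0 (Matrix.specialUnitaryGroup (Fin 2) ℂ)) (X : PBond (F.P K) 0 → Matrix (Fin 2) (Fin 2) ℂ) :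
    ∑ b : PBond (F.P K) 0, Matrix.trace ((X b).conjTranspose * covCodiffCurlT 1 (bgUnits F K U₀) X b.dir b.src)
      = ∑ q ∈ posPlaq (Site (F.P K) 0) (Fin (F.P K).d),
          Matrix.trace ((curl (torusT (F.P K) 0) (fun μ x => bgUnits F K U₀ ⟨x, μ⟩) (formComp X) q.2.1 q.2.2 q.1).conjTranspose
            * curl (torusT (F.P K) 0) (fun μ x => bgUnits F K U₀ ⟨x, μ⟩) (formComp X) q.2.1 q.2.2 q.1) := by
  set T := torusT (F.P K) 0 with hT
  set U : Fin (F.P K).d → Site (F.P K) 0 → (Matrix (Fin 2) (Fin 2) ℂ)ˣ := fun μ x => bgUnits F K U₀ ⟨x, μ⟩ with hU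
  have hUu : ∀ μ x, (((U μ x)⁻¹ : (Matrix (Fin 2) (Fin 2) ℂ)ˣ) : Matrix (Fin 2) (Fin 2) ℂ) = star (U μ x : Matrix (Fin 2) (Fin 2) ℂ) :=
    fun μ x => by rw [hU]; exact val_inv_bgUnits_eq_star U₀ μ x
  have hτ : ∀ a b : Matrix (Fin 2) (Fin 2) ℂ, Matrix.traceAddMonoidHom (Fin 2) ℂ (a * b) = Matrix.traceAddMonoidHom (Fin 2) ℂ (b * a) :=
    fun a b => Matrix.trace_mul_comm a b
  rw [sum_pbond_eq]
  have h1 : ∀ (x : Site (F.P K) 0) (μ : Fin (F.P K).d),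
      Matrix.trace ((X ⟨x, μ⟩).conjTranspose * covCodiffCurlT 1 (bgUnits F K U₀) X μ x)
        = Matrix.traceAddMonoidHom (Fin 2) ℂ (formComp (star X) μ x * divP T U (curl T U (formComp X)) μ x) := by
    intro x μ
    rw [covCodiffCurlT_one_eq, formComp_star]
    rfl
  simp_rw [h1, ← sum_posPlaq_curl_mul T U (Matrix.traceAddMonoidHom (Fin 2) ℂ) hτ]
  refine Finset.sum_congr rfl fun q _ => ?_
  rw [formComp_star, ← star_curl T U hUu, Matrix.star_eq_conjTranspose]
  rfl

/-- **THE `D*D` PART IS A SUM OF SQUARES**: `Σ_b tr(X_b† (D¹*D¹_{U₀}X)_b) = Σ_p ‖(D¹X)_p‖_F²` (as a complex number), hence real and `≥ 0` — «the basic operator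
generalizing the operator d*d in the Abelian case» is positive on ALL complex one-forms. [cite: Balaban1985BackgroundPropagators, (3.9)–(3.10) p.392] -/
theorem sum_trace_conjTranspose_mul_covCodiffCurlT_eq_sum_sq (U₀ : GaugeField (F.P K) 0 (Matrix.specialUnitaryGroup (Fin 2) ℂ))
    (X : PBond (F.P K) 0 → Matrix (Fin 2) (Fin 2) ℂ) :
    ∑ b : PBond (F.P K) 0, Matrix.trace ((X b).conjTranspose * covCodiffCurlT 1 (bgUnits F K U₀) X b.dir b.src)
      = ((∑ q ∈ posPlaq (Site (F.P K) 0) (Fin (F.P K).d),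
          ‖(frobEquiv.symm (curl (torusT (F.P K) 0) (fun μ x => bgUnits F K U₀ ⟨x, μ⟩) (formComp X) q.2.1 q.2.2 q.1) : W₂)‖ ^ 2 : ℝ) : ℂ) := by
  rw [sum_trace_conjTranspose_mul_covCodiffCurlT]
  push_cast
  refine Finset.sum_congr rfl fun q _ => ?_
  rw [← inner_frobEquiv_symm, inner_self_eq_norm_sq_to_K]
  norm_cast

/-- `0 ≤ re Σ_b tr(X_b† (D¹*D¹_{U₀}X)_b)`. [cite: Balaban1985BackgroundPropagators, (3.10) p.392] -/
theorem re_sum_trace_conjTranspose_mul_covCodiffCurlT_nonneg (U₀ : GaugeField (F.P K) 0 (Matrix.specialUnitaryGroup (Fin 2) ℂ))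
    (X : PBond (F.P K) 0 → Matrix (Fin 2) (Fin 2) ℂ) :
    0 ≤ (∑ b : PBond (F.P K) 0, Matrix.trace ((X b).conjTranspose * covCodiffCurlT 1 (bgUnits F K U₀) X b.dir b.src)).re := by
  rw [sum_trace_conjTranspose_mul_covCodiffCurlT_eq_sum_sq, Complex.ofReal_re]
  exact Finset.sum_nonneg fun q _ => sq_nonneg _


/-! ## §3 ALMOST-POSITIVITY OF THE WILSON HESSIAN `Δ^η(U₀)` ON THE PRINTED-REGULAR CLASS -/

/-- **`‖X̃‖² = c₀·Σ_b ‖X_b‖_F²`** for `X̃ = toL2 X`. [cite: Balaban1985BackgroundPropagators, (3.11) p.392] -/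
theorem norm_toL2_sq [Fact (0 < c₀)] (X : PBond (F.P K) 0 → Matrix (Fin 2) (Fin 2) ℂ) :
    ‖toL2 F K c₀ X‖ ^ 2 = c₀ * ∑ b : PBond (F.P K) 0, ‖(frobEquiv.symm (X b) : W₂)‖ ^ 2 := by
  have h2 : ∀ b : PBond (F.P K) 0, Matrix.trace ((X b).conjTranspose * X b) = (((‖(frobEquiv.symm (X b) : W₂)‖ ^ 2 : ℝ)) : ℂ) := by
    intro b
    rw [← inner_frobEquiv_symm, inner_self_eq_norm_sq_to_K]
    norm_cast
  rw [@norm_sq_eq_re_inner ℂ, inner_toL2]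
  simp_rw [h2]
  rw [← Complex.ofReal_sum, ← Complex.ofReal_mul, RCLike.re_to_complex, Complex.ofReal_re]

/-- ★★ **THE QUADRATIC FORM OF `Δ^η(U₀)` ON THE ROUTE CARRIER**: `re⟪X̃, Δ^η X̃⟫ = c₀·η⁻²·(re Σ_b tr(X_b†(D¹*D¹X)_b) + re Σ_b tr(X_b†(Δ′₁X)_b))` — (3.10) `Δ^η = η⁻²(D¹*D¹ + Δ′₁)` paired with
`X̃` (✓`symm_DeltaEta_toL2_apply`, ✓`inner_toL2`). [cite: Balaban1985BackgroundPropagators, (3.10)–(3.12) p.392] -/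
theorem re_inner_DeltaEta_toL2_eq [Fact (0 < c₀)] (U₀ : GaugeField (F.P K) 0 (Matrix.specialUnitaryGroup (Fin 2) ℂ)) (X : PBond (F.P K) 0 → Matrix (Fin 2) (Fin 2) ℂ) :
    RCLike.re ⟪toL2 F K c₀ X, DeltaEta F n K c₀ U₀ (toL2 F K c₀ X)⟫_ℂ
      = c₀ * (eta F n K)⁻¹ ^ 2 *
        ((∑ b : PBond (F.P K) 0, Matrix.trace ((X b).conjTranspose * covCodiffCurlT 1 (bgUnits F K U₀) X b.dir b.src)).re
          + (∑ b : PBond (F.P K) 0, Matrix.trace ((X b).conjTranspose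
              * deltaPrimeOp (torusT (F.P K) 0) (fun μ x => bgUnits F K U₀ ⟨x, μ⟩) 1 (formComp X) b.dir b.src)).re) := by
  have hΔ : DeltaEta F n K c₀ U₀ (toL2 F K c₀ X) = toL2 F K c₀ (fun b : PBond (F.P K) 0 => ((((eta F n K)⁻¹ ^ 2 : ℝ) : ℂ)) •
      (covCodiffCurlT 1 (bgUnits F K U₀) X b.dir b.src
        + deltaPrimeOp (torusT (F.P K) 0) (fun μ x => bgUnits F K U₀ ⟨x, μ⟩) 1 (formComp X) b.dir b.src)) := by
    rw [← LinearEquiv.symm_apply_eq]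
    funext b
    exact symm_DeltaEta_toL2_apply U₀ X b
  rw [hΔ, inner_toL2]
  simp only [Matrix.mul_smul, Matrix.trace_smul, Matrix.trace_add, smul_add, smul_eq_mul, Finset.sum_add_distrib,
    ← Finset.mul_sum, mul_add, RCLike.re_to_complex, Complex.add_re, Complex.re_ofReal_mul]
  ring

/-- ★★★ **ALMOST-POSITIVITY OF `Δ^η(U₀)` ON THE ROUTE CARRIER**: on `RegPr F n K ε₀ U₀` (`0 ≤ ε₀`), for every complex one-form `X`,
`−1029·ε₀·‖X̃‖² ≤ re⟪X̃, Δ^η(U₀) X̃⟫` — the `D*D` part is a sum of squares (§1) and the curvature part `Δ′` is `≤ 1029·ε₀η²` in `L²` (§2); the `η⁻²` of (3.10) cancels the `η²` of the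
plaquette window, `c₀` cancels in the quotient: an ABSOLUTE, `η`- and `c₀`-FREE constant. [cite: Balaban1985BackgroundPropagators, (3.10) p.392, (3.69) p.404; Balaban1985Variational, (14) p.280] -/
theorem re_inner_DeltaEta_toL2_ge [Fact (0 < c₀)] {ε₀ : ℝ} (hε₀ : 0 ≤ ε₀) (U₀ : GaugeField (F.P K) 0 (Matrix.specialUnitaryGroup (Fin 2) ℂ))
    (hreg : RegPr F n K ε₀ U₀) (X : PBond (F.P K) 0 → Matrix (Fin 2) (Fin 2) ℂ) :
    -(1029 * ε₀ * ‖toL2 F K c₀ X‖ ^ 2) ≤ RCLike.re ⟪toL2 F K c₀ X, DeltaEta F n K c₀ U₀ (toL2 F K c₀ X)⟫_ℂ := by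
  have hc₀ : 0 < c₀ := Fact.out
  have hη : 0 < eta F n K := eta_pos F n K
  rw [re_inner_DeltaEta_toL2_eq, norm_toL2_sq]
  set SF : ℝ := ∑ b : PBond (F.P K) 0, ‖(frobEquiv.symm (X b) : W₂)‖ ^ 2 with hSF
  have hP := re_sum_trace_conjTranspose_mul_covCodiffCurlT_nonneg U₀ X
  have hD := norm_sum_trace_conjTranspose_mul_deltaPrimeOp_le hε₀ U₀ hreg X
  have hDre : -(1029 * (ε₀ * eta F n K ^ 2) * SF)
      ≤ (∑ b : PBond (F.P K) 0, Matrix.trace ((X b).conjTranspose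
          * deltaPrimeOp (torusT (F.P K) 0) (fun μ x => bgUnits F K U₀ ⟨x, μ⟩) 1 (formComp X) b.dir b.src)).re := by
    have h1 := (RCLike.re_le_norm (K := ℂ) (∑ b : PBond (F.P K) 0, Matrix.trace ((X b).conjTranspose
      * deltaPrimeOp (torusT (F.P K) 0) (fun μ x => bgUnits F K U₀ ⟨x, μ⟩) 1 (formComp X) b.dir b.src)))
    have h2 := Complex.abs_re_le_norm (∑ b : PBond (F.P K) 0, Matrix.trace ((X b).conjTranspose
      * deltaPrimeOp (torusT (F.P K) 0) (fun μ x => bgUnits F K U₀ ⟨x, μ⟩) 1 (formComp X) b.dir b.src))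
    have h3 := neg_le_of_abs_le (h2.trans hD)
    exact h3
  have hk : 0 ≤ c₀ * (eta F n K)⁻¹ ^ 2 := by positivity
  calc -(1029 * ε₀ * (c₀ * SF)) = c₀ * (eta F n K)⁻¹ ^ 2 * (0 + -(1029 * (ε₀ * eta F n K ^ 2) * SF)) := by field_simp; ring
    _ ≤ c₀ * (eta F n K)⁻¹ ^ 2 * ((∑ b : PBond (F.P K) 0, Matrix.trace ((X b).conjTranspose * covCodiffCurlT 1 (bgUnits F K U₀) X b.dir b.src)).re
          + (∑ b : PBond (F.P K) 0, Matrix.trace ((X b).conjTranspose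
              * deltaPrimeOp (torusT (F.P K) 0) (fun μ x => bgUnits F K U₀ ⟨x, μ⟩) 1 (formComp X) b.dir b.src)).re) :=
        mul_le_mul_of_nonneg_left (add_le_add hP hDre) hk

/-- ★★★ **ALMOST-POSITIVITY OF THE HESSIAN LETTER `DeltaEtaSlot` ON THE WHOLE WEIGHTED `L²` SPACE** — the hypothesis `hθ` of ✓`Prop7CoerciveOfInverseBound.coercive_laplaceA_of_almostPos_of_inverse_bound`
at the slot of record with `θ := 1029·ε₀`: on `RegPr F n K ε₀ U₀` (`0 ≤ ε₀`), `−(1029·ε₀)·‖y‖² ≤ re⟪y, Δ^η(U₀) y⟫` for EVERY `y`. Consequently (RULING g28-№13 refined, ACK 91 (3)) the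
quantitative coercivity row of `Δ_a(U₀) = Δ^η + D R_S D* + Q_k† a Q_k` follows from the `norm_G₀` row ALONE, with `γ = 1∕B₀` on the window `1029·ε₀·B₀ < 1`.
[cite: Balaban1985BackgroundPropagators, (3.10) p.392, Thm 3.11 p.416; Balaban1985Variational, (14) p.280, p.299] -/
theorem almostPos_DeltaEtaSlot_of_regPr [Fact (0 < c₀)] {ε₀ : ℝ} (hε₀ : 0 ≤ ε₀) (U₀ : GaugeField (F.P K) 0 (Matrix.specialUnitaryGroup (Fin 2) ℂ))
    (hreg : RegPr F n K ε₀ U₀) (y : BondL2K ℂ 3 (periodsT3 F K) c₀ W₂) :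
    -((1029 * ε₀) * ‖y‖ ^ 2) ≤ RCLike.re ⟪y, DeltaEtaSlot F n K c₀ U₀ y⟫_ℂ := by
  obtain ⟨X, rfl⟩ := (toL2 F K c₀).surjective y
  rw [DeltaEtaSlot_apply]
  have h := re_inner_DeltaEta_toL2_ge (c₀ := c₀) hε₀ U₀ hreg X
  convert h using 2

end Summit.QuantumFields.YangMills.Theorems.Prop7DeltaEtaAlmostPositive

end
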